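import Summits.Ventures.HSemireg.ContractionSpanThetaSecantIndep
import Summits.Ventures.HSemireg.ContractionSpanKunnethBox
import HarnessLib

/-!
# Venture HSemireg — the THETA BOX: `r((a₁ + b₁e^{c₁}) ∧ (a₂ + b₂e^{c₂})) = 2·C(n,2)·1 + 2n·2n + 1·2·C(n,2) = 6n² − 2n`
# (`18` at `n = 2`) — th-7's theta-divisor row TH, class side, for all `n`

HONEST FRAMING. Pure linear algebra: seat p4's Künneth count (`ContractionSpanKunnethRank.finrank_span_mul_eq`,
transport `ContractionSpanKunnethBox.finrank_span(₁)_map_eq`) fed with this seat's theta-secant factor numbers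
(`ContractionSpanThetaSecantDarboux`) and independence (`ContractionSpanThetaSecantIndep`). It is the class-side
statement of `theory/FORMULA-N-th7.md` §E row TH («theta-divisor box `Φ((i_*L)^∨ ⊠ i_*L)(⊗M)` … `P_n(t)²`, `R₂(n)`») in the
SOURCE frame `X × X̂ ∋ (i_*L)^∨ ⊠ i_*L` (the FM / twist moves to the census frame are `ContractionSpanFourierDual*` /
`ContractionSpanTwist`, class level; `ch` itself stays BY VALUE). Nothing here is a claim about any explicit variety; nothing
here says that HC / HC_CM / HC_AV holds. Everything is PROVED; no named fact, no new definition.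
References: [BourbakiAlgebre1a3] Ch. III §7 no. 7, §11 no. 9; [BuchweitzFlenner2008HH] Prop. 6.4.4;
[Lange2023AbelianVarietiesComplex] §7.3.2; [McDuffSalamon2017] Thm. 2.1.3.
-/

noncomputable section

open CliffordAlgebra (contractLeft)
open ExteriorAlgebra (ι)
open Module
open Literature.AlgebraicGeometry.Motives Literature.AlgebraicGeometry.HodgeTheory

namespace Summit.Ventures.HSemireg

namespace ContractionSpan

section Factor
variable {K : Type*} [Field K] [CharZero K] {V : Type*} [AddCommGroup V] [Module K V] {V₁ V₂ L₁ : Submodule K V}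
  {n : ℕ} (b₁ : Module.Basis (Fin n ⊕ Fin n) K V₁)

omit [CharZero K] in
/-- `span₁ L Θ 0 = 0`. [folklore] -/
theorem span₁_zero (L : Set V) (Θ : Set (Module.Dual K V)) : span₁ L Θ (0 : ExteriorAlgebra K V) = ⊥ := by
  rw [span₁, Submodule.span_eq_bot]
  rintro y (⟨q, -, rfl⟩ | ⟨θ, -, rfl⟩)
  · rw [mul_zero]
  · rw [map_zero]

omit [CharZero K] in
/-- `Λι₁` of the theta class: `Λι₁(a·1 + a'·Σ cᵏ/k!) = a·1 + a'·Σ (Λι₁ c)ᵏ/k!`. [cite: BourbakiAlgebre1a3, Ch. III §7 no. 2] -/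
theorem map_thetaSecant_eq (a a' : K) (N : ℕ) :
    ExteriorAlgebra.map V₁.subtype (algebraMap K _ a + a' • ∑ k ∈ Finset.range N,
        ((k.factorial : K)⁻¹) • ExteriorLefschetz.twoVector b₁ ^ k) =
      algebraMap K (ExteriorAlgebra K V) a + a' • ∑ k ∈ Finset.range N,
        ((k.factorial : K)⁻¹) • ExteriorAlgebra.map V₁.subtype (ExteriorLefschetz.twoVector b₁) ^ k := by
  rw [map_add, AlgHom.commutes, map_smul, map_sum]
  simp_rw [map_smul, map_pow]

omit [CharZero K] in
/-- The theta class pushed into `Λ V` is EVEN (lies in `Λ^{even} V₁`). [cite: BourbakiAlgebre1a3, Ch. III §7 no. 2] -/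
theorem map_thetaSecant_mem_evenFactorAlg (a a' : K) (N : ℕ) :
    ExteriorAlgebra.map V₁.subtype (algebraMap K _ a + a' • ∑ k ∈ Finset.range N,
        ((k.factorial : K)⁻¹) • ExteriorLefschetz.twoVector b₁ ^ k) ∈ evenFactorAlg V₁ := by
  rw [map_add, AlgHom.commutes, map_smul, map_sum]
  refine Subalgebra.add_mem _ (Subalgebra.algebraMap_mem _ a) (Subalgebra.smul_mem _ (Subalgebra.sum_mem _ fun k _ => ?_) a')
  rw [map_smul]
  refine Subalgebra.smul_mem _ ?_ _
  have h := map_mem_evenFactorAlg V₁.subtype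
    (ExteriorLefschetz.pow_mem_exteriorPower (ExteriorLefschetz.twoVector_mem b₁) k)
  rwa [Submodule.range_subtype] at h

omit [CharZero K] in
/-- `Λι₁ c` is a twist class of `L₁` inside `Λ V` (`c = Σ pᵢ ∧ qᵢ`, `qᵢ ∈ L₁`). [cite: McDuffSalamon2017, Thm. 2.1.3] -/
theorem map_twoVector_mem_twist (hbL : Submodule.span K (Set.range (⇑b₁ ∘ Sum.inr)) = L₁.comap V₁.subtype) :
    ExteriorAlgebra.map V₁.subtype (ExteriorLefschetz.twoVector b₁) ∈
      Submodule.span K {z : ExteriorAlgebra K V | ∃ v : V, ∃ q ∈ (L₁ : Set V), z = ι K v * ι K q} := by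
  rw [ExteriorLefschetz.twoVector, map_sum]
  refine Submodule.sum_mem _ fun i _ => ?_
  rw [map_mul, ExteriorAlgebra.map_apply_ι, ExteriorAlgebra.map_apply_ι]
  have hq : (b₁ (Sum.inr i) : V) ∈ L₁ := by
    have h : b₁ (Sum.inr i) ∈ L₁.comap V₁.subtype := by rw [← hbL]; exact Submodule.subset_span ⟨i, rfl⟩
    exact h
  exact Submodule.subset_span ⟨_, _, hq, rfl⟩

omit [CharZero K] in
/-- A form killing `L₁` kills the `Λ²`-block of `L₁` under `ι`. [cite: BourbakiAlgebre1a3, Ch. III §11 no. 9] -/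
theorem contractLeft_eq_zero_of_mem_wedgeBlock {θ : Module.Dual K V} (hθ : ∀ q ∈ L₁, θ q = 0) {w : ExteriorAlgebra K V}
    (hw : w ∈ wedgeBlock (K := K) (L₁ : Set V)) : contractLeft θ w = 0 := by
  induction hw using Submodule.span_induction with
  | mem y hy =>
    obtain ⟨q₁, hq₁, q₂, hq₂, rfl⟩ := hy
    rw [CliffordAlgebra.contractLeft_ι_mul, hθ q₁ hq₁, zero_smul, CliffordAlgebra.contractLeft_ι, hθ q₂ hq₂, map_zero,
      mul_zero, sub_zero]
  | zero => rw [map_zero]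
  | add y z _ _ hy hz => rw [map_add, hy, hz, add_zero]
  | smul r y _ hy => rw [map_smul, hy, smul_zero]

omit [CharZero K] in
/-- The extended coordinate form `pⱼ* ∘ pr₁` contracts `Λι₁ c` to `ι₁ qⱼ`. [cite: BourbakiAlgebre1a3, Ch. III §11 no. 9] -/
theorem contractLeft_coord_proj_map_twoVector (hV : IsCompl V₁ V₂) (j : Fin n) :
    contractLeft ((b₁.coord (Sum.inl j)) ∘ₗ V₁.projectionOnto V₂ hV)
        (ExteriorAlgebra.map V₁.subtype (ExteriorLefschetz.twoVector b₁)) = ι K (b₁ (Sum.inr j) : V) := by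
  rw [contractLeft_map, comp_projectionOnto_comp_subtype, contractLeft_coord_inl_twoVector, ExteriorAlgebra.map_apply_ι,
    Submodule.subtype_apply]

omit [CharZero K] in
/-- `Λι₁ c ∉ Λ²`-block of `L₁` (for `n ≥ 1`): `pⱼ* ∘ pr₁` kills the block but contracts `Λι₁ c` to `ι₁ qⱼ ≠ 0`.
[cite: BourbakiAlgebre1a3, Ch. III §11 no. 9] -/
theorem map_twoVector_not_mem_wedgeBlock (hV : IsCompl V₁ V₂) (hL₁ : L₁ ≤ V₁)
    (hbL : Submodule.span K (Set.range (⇑b₁ ∘ Sum.inr)) = L₁.comap V₁.subtype) (hn : 0 < n) :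
    ExteriorAlgebra.map V₁.subtype (ExteriorLefschetz.twoVector b₁) ∉ wedgeBlock (K := K) (L₁ : Set V) := by
  intro hmem
  set j : Fin n := ⟨0, hn⟩
  have hφ := comp_projectionOnto_mem_factorForms hV hL₁ (θ' := b₁.coord (Sum.inl j)) fun q hq =>
    coord_inl_apply_eq_zero b₁ j (by rw [hbL]; exact hq)
  have h0 := contractLeft_eq_zero_of_mem_wedgeBlock (θ := (b₁.coord (Sum.inl j)) ∘ₗ V₁.projectionOnto V₂ hV) hφ.1 hmem
  rw [contractLeft_coord_proj_map_twoVector b₁ hV j, ExteriorAlgebra.ι_eq_zero_iff, Submodule.coe_eq_zero] at h0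
  exact b₁.ne_zero (Sum.inr j) h0

omit [CharZero K] in
/-- Non-degeneracy inside `Λ V`: `ι q`, `q ∈ L₁`, lies in the span of the `ι_φ (Λι₁ c)`, `φ` a factor form.
[cite: McDuffSalamon2017, Thm. 2.1.3] -/
theorem ι_mem_span_contractLeft_map_twoVector (hV : IsCompl V₁ V₂) (hL₁ : L₁ ≤ V₁)
    (hbL : Submodule.span K (Set.range (⇑b₁ ∘ Sum.inr)) = L₁.comap V₁.subtype) {q : V} (hq : q ∈ (L₁ : Set V)) :
    ι K q ∈ Submodule.span K {y : ExteriorAlgebra K V | ∃ φ ∈ factorForms L₁ V₂,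
      y = contractLeft φ (ExteriorAlgebra.map V₁.subtype (ExteriorLefschetz.twoVector b₁))} := by
  have hq' : (⟨q, hL₁ hq⟩ : V₁) ∈ (Submodule.span K (Set.range (⇑b₁ ∘ Sum.inr)) : Set V₁) := by
    rw [hbL]; exact hq
  have h := Submodule.mem_map_of_mem (f := (ExteriorAlgebra.map V₁.subtype).toLinearMap)
    (ι_mem_span_contractLeft_twoVector b₁ hq')
  rw [AlgHom.toLinearMap_apply, ExteriorAlgebra.map_apply_ι, Submodule.subtype_apply, Submodule.map_span] at h
  refine (Submodule.span_mono ?_) h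
  rintro _ ⟨_, ⟨φ', hφ', rfl⟩, rfl⟩
  refine ⟨φ' ∘ₗ V₁.projectionOnto V₂ hV, comp_projectionOnto_mem_factorForms hV hL₁ fun q hq => hφ' q (by rwa [hbL]), ?_⟩
  rw [AlgHom.toLinearMap_apply, contractLeft_map, comp_projectionOnto_comp_subtype]

/-- `dim S²(x₁) = 2·C(n,2)` inside `Λ V` for the theta factor, `n ≥ 3` (transported `finrank_span_thetaSecant`).
[cite: BuchweitzFlenner2008HH, Prop. 6.4.4] [cite: Lange2023AbelianVarietiesComplex, §7.3.2 (1)] -/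
theorem finrank_span_thetaSecant_map (hV : IsCompl V₁ V₂) (hL₁ : L₁ ≤ V₁)
    (hbL : Submodule.span K (Set.range (⇑b₁ ∘ Sum.inr)) = L₁.comap V₁.subtype) (hn : 3 ≤ n) {N : ℕ}
    (hN : ExteriorLefschetz.twoVector b₁ ^ N = 0) {a a' : K} (ha : a ≠ 0) (ha' : a' ≠ 0) :
    finrank K (span (L₁ : Set V) (factorForms L₁ V₂) (ExteriorAlgebra.map V₁.subtype (algebraMap K _ a +
      a' • ∑ k ∈ Finset.range N, ((k.factorial : K)⁻¹) • ExteriorLefschetz.twoVector b₁ ^ k))) = 2 * n.choose 2 := by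
  rw [finrank_span_map_eq hV hL₁, ← hbL]
  exact finrank_span_thetaSecant b₁ hn hN ha ha'

/-- `dim S¹(x₁) = 2n` inside `Λ V` for the theta factor, `n ≥ 2`. [cite: BuchweitzFlenner2008HH, Prop. 6.4.4] -/
theorem finrank_span₁_thetaSecant_map (hV : IsCompl V₁ V₂) (hL₁ : L₁ ≤ V₁)
    (hbL : Submodule.span K (Set.range (⇑b₁ ∘ Sum.inr)) = L₁.comap V₁.subtype) (hn : 2 ≤ n) {N : ℕ}
    (hN : ExteriorLefschetz.twoVector b₁ ^ N = 0) {a a' : K} (ha : a ≠ 0) (ha' : a' ≠ 0) :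
    finrank K (span₁ (L₁ : Set V) (factorForms L₁ V₂) (ExteriorAlgebra.map V₁.subtype (algebraMap K _ a +
      a' • ∑ k ∈ Finset.range N, ((k.factorial : K)⁻¹) • ExteriorLefschetz.twoVector b₁ ^ k))) = 2 * n := by
  rw [finrank_span₁_map_eq hV hL₁, ← hbL]
  exact finrank_span₁_thetaSecant b₁ hn hN ha ha'

/-- `dim K·x₁ = 1` for the theta factor (`x₁ ≠ 0` since its degree-one span has dimension `2n > 0`). [folklore] -/
theorem finrank_span_singleton_thetaSecant (hV : IsCompl V₁ V₂) (hL₁ : L₁ ≤ V₁)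
    (hbL : Submodule.span K (Set.range (⇑b₁ ∘ Sum.inr)) = L₁.comap V₁.subtype) (hn : 2 ≤ n) {N : ℕ}
    (hN : ExteriorLefschetz.twoVector b₁ ^ N = 0) {a a' : K} (ha : a ≠ 0) (ha' : a' ≠ 0) :
    finrank K (K ∙ ExteriorAlgebra.map V₁.subtype (algebraMap K _ a +
      a' • ∑ k ∈ Finset.range N, ((k.factorial : K)⁻¹) • ExteriorLefschetz.twoVector b₁ ^ k)) = 1 := by
  refine finrank_span_singleton fun h0 => ?_
  have h := finrank_span₁_thetaSecant_map b₁ hV hL₁ hbL hn hN ha ha' (V₂ := V₂)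
  rw [h0, span₁_zero, finrank_bot] at h
  omega

/-- Independence of the three theta-factor spans inside `Λ V` (both orders). [cite: BourbakiAlgebre1a3, Ch. III §7 no. 1] -/
theorem iSupIndep_spans_thetaSecant_map (hV : IsCompl V₁ V₂) (hL₁ : L₁ ≤ V₁)
    (hbL : Submodule.span K (Set.range (⇑b₁ ∘ Sum.inr)) = L₁.comap V₁.subtype) (hn : 0 < n) {N : ℕ}
    (hN : ExteriorLefschetz.twoVector b₁ ^ N = 0) {a a' : K} (ha : a ≠ 0) (ha' : a' ≠ 0) :
    iSupIndep ![span (L₁ : Set V) (factorForms L₁ V₂) (ExteriorAlgebra.map V₁.subtype (algebraMap K _ a +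
          a' • ∑ k ∈ Finset.range N, ((k.factorial : K)⁻¹) • ExteriorLefschetz.twoVector b₁ ^ k)),
        span₁ (L₁ : Set V) (factorForms L₁ V₂) (ExteriorAlgebra.map V₁.subtype (algebraMap K _ a +
          a' • ∑ k ∈ Finset.range N, ((k.factorial : K)⁻¹) • ExteriorLefschetz.twoVector b₁ ^ k)),
        K ∙ ExteriorAlgebra.map V₁.subtype (algebraMap K _ a +
          a' • ∑ k ∈ Finset.range N, ((k.factorial : K)⁻¹) • ExteriorLefschetz.twoVector b₁ ^ k)] ∧
      iSupIndep ![K ∙ ExteriorAlgebra.map V₁.subtype (algebraMap K _ a +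
          a' • ∑ k ∈ Finset.range N, ((k.factorial : K)⁻¹) • ExteriorLefschetz.twoVector b₁ ^ k),
        span₁ (L₁ : Set V) (factorForms L₁ V₂) (ExteriorAlgebra.map V₁.subtype (algebraMap K _ a +
          a' • ∑ k ∈ Finset.range N, ((k.factorial : K)⁻¹) • ExteriorLefschetz.twoVector b₁ ^ k)),
        span (L₁ : Set V) (factorForms L₁ V₂) (ExteriorAlgebra.map V₁.subtype (algebraMap K _ a +
          a' • ∑ k ∈ Finset.range N, ((k.factorial : K)⁻¹) • ExteriorLefschetz.twoVector b₁ ^ k))] := by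
  have hN' : ExteriorAlgebra.map V₁.subtype (ExteriorLefschetz.twoVector b₁) ^ N = 0 := by rw [← map_pow, hN, map_zero]
  rw [map_thetaSecant_eq]
  exact iSupIndep_spans_secant (fun θ hθ q hq => hθ.1 q hq) (map_twoVector_mem_twist b₁ hbL) hN'
    (map_twoVector_not_mem_wedgeBlock b₁ hV hL₁ hbL hn) (fun q hq => ι_mem_span_contractLeft_map_twoVector b₁ hV hL₁ hbL hq)
    ha ha'

/-- `n = 1` (elliptic curve): the `Λ²`-block of a line is `0`, so `dim S²(x₁) = 0` for the theta factor.
[cite: BourbakiAlgebre1a3, Ch. III §7 no. 3 Prop. 6] -/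
theorem finrank_span_thetaSecant_map_one (b₁ : Module.Basis (Fin 1 ⊕ Fin 1) K V₁) (hV : IsCompl V₁ V₂) (hL₁ : L₁ ≤ V₁)
    (hbL : Submodule.span K (Set.range (⇑b₁ ∘ Sum.inr)) = L₁.comap V₁.subtype) {N : ℕ}
    (hN : ExteriorLefschetz.twoVector b₁ ^ N = 0) {a a' : K} (ha : a ≠ 0) (ha' : a' ≠ 0) :
    finrank K (span (L₁ : Set V) (factorForms L₁ V₂) (ExteriorAlgebra.map V₁.subtype (algebraMap K _ a +
      a' • ∑ k ∈ Finset.range N, ((k.factorial : K)⁻¹) • ExteriorLefschetz.twoVector b₁ ^ k))) = 0 := by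
  haveI : FiniteDimensional K V₁ := Module.Finite.of_basis b₁
  haveI : FiniteDimensional K (wedgeBlock (K := K) (Submodule.span K (Set.range (⇑b₁ ∘ Sum.inr)) : Set V₁)) :=
    Submodule.finiteDimensional_of_le (wedgeBlock_le _)
  have hW : wedgeBlock (K := K) (Submodule.span K (Set.range (⇑b₁ ∘ Sum.inr)) : Set V₁) = ⊥ := by
    rw [← Submodule.finrank_eq_zero, finrank_wedgeBlock, finrank_span_range_inr]; rfl
  rw [finrank_span_map_eq hV hL₁, ← hbL,
    finrank_span_secant_eq_add (L := (Submodule.span K (Set.range (⇑b₁ ∘ Sum.inr)) : Set V₁))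
      (Θ := {θ : Module.Dual K V₁ | ∀ q ∈ Submodule.span K (Set.range (⇑b₁ ∘ Sum.inr)), θ q = 0})
      (fun θ hθ q hq => hθ q hq) (twoVector_mem_twist b₁) hN (fun q hq => ι_mem_span_contractLeft_twoVector b₁ hq) ha ha',
    hW, Submodule.map_bot, finrank_bot]

/-- `n = 1`: `dim S¹(x₁) = 1` for the theta factor (`c ∧ q = p ∧ q ∧ q = 0`, so only the line `ι(L)` survives).
[cite: BourbakiAlgebre1a3, Ch. III §7 no. 3 Prop. 6] -/
theorem finrank_span₁_thetaSecant_map_one (b₁ : Module.Basis (Fin 1 ⊕ Fin 1) K V₁) (hV : IsCompl V₁ V₂)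
    (hL₁ : L₁ ≤ V₁) (hbL : Submodule.span K (Set.range (⇑b₁ ∘ Sum.inr)) = L₁.comap V₁.subtype) {N : ℕ}
    (hN : ExteriorLefschetz.twoVector b₁ ^ N = 0) {a a' : K} (ha : a ≠ 0) (ha' : a' ≠ 0) :
    finrank K (span₁ (L₁ : Set V) (factorForms L₁ V₂) (ExteriorAlgebra.map V₁.subtype (algebraMap K _ a +
      a' • ∑ k ∈ Finset.range N, ((k.factorial : K)⁻¹) • ExteriorLefschetz.twoVector b₁ ^ k))) = 1 := by
  haveI : FiniteDimensional K V₁ := Module.Finite.of_basis b₁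
  haveI : FiniteDimensional K (vecBlock (K := K) (Submodule.span K (Set.range (⇑b₁ ∘ Sum.inr)) : Set V₁)) :=
    Submodule.finiteDimensional_of_le (vecBlock_le _)
  have h0 : (vecBlock (K := K) (Submodule.span K (Set.range (⇑b₁ ∘ Sum.inr)) : Set V₁)).map
      (LinearMap.mulLeft K (ExteriorLefschetz.twoVector b₁)) = ⊥ := by
    rw [eq_bot_iff, Submodule.map_le_iff_le_comap]
    refine Submodule.span_le.mpr ?_
    rintro y ⟨q, hq, rfl⟩
    obtain ⟨f, rfl⟩ := (Submodule.mem_span_range_iff_exists_fun K).mp hq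
    rw [SetLike.mem_coe, Submodule.mem_comap, LinearMap.mulLeft_apply, ExteriorLefschetz.twoVector]
    simp only [Finset.univ_unique, Fin.default_eq_zero, Finset.sum_singleton, Function.comp_apply, map_smul,
      mul_smul_comm, mul_assoc, ExteriorAlgebra.ι_sq_zero, mul_zero, smul_zero]
    exact Submodule.zero_mem _
  rw [finrank_span₁_map_eq hV hL₁, ← hbL,
    finrank_span₁_secant_eq_add (L := (Submodule.span K (Set.range (⇑b₁ ∘ Sum.inr)) : Set V₁))
      (Θ := {θ : Module.Dual K V₁ | ∀ q ∈ Submodule.span K (Set.range (⇑b₁ ∘ Sum.inr)), θ q = 0})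
      (fun θ hθ q hq => hθ q hq) (twoVector_mem_twist b₁) hN (fun q hq => ι_mem_span_contractLeft_twoVector b₁ hq) ha ha',
    h0, finrank_bot, add_zero, finrank_vecBlock, finrank_span_range_inr]

end Factor

/-! ### The theta box -/

section Box
variable {K : Type*} [Field K] [CharZero K] {V : Type*} [AddCommGroup V] [Module K V] [FiniteDimensional K V]
  {V₁ V₂ L₁ L₂ : Submodule K V}

/-- **THE THETA BOX, `n ≥ 3`: `dim = 2·C(n,2)·1 + 2n·2n + 1·2·C(n,2) = 6n² − 2n`** for the product of two theta-secant
factors `aᵢ·1 + aᵢ'·e^{cᵢ}` (`cᵢ = Σ p ∧ q` the 2-vector of a Darboux basis of `Vᵢ` whose `q`'s span `Lᵢ`), with respect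
to `(L₁ ⊕ L₂, (L₁ ⊕ L₂)^⊥)` — th-7's row TH «`P_n(t)²` at `t²`», same number as the point-pair box.
[cite: BuchweitzFlenner2008HH, Prop. 6.4.4] [cite: BourbakiAlgebre1a3, Ch. III §7 no. 7 and §11 no. 9] -/
theorem finrank_span_thetaBox (hV : IsCompl V₁ V₂) {n : ℕ} (hn : 3 ≤ n) (b₁ : Module.Basis (Fin n ⊕ Fin n) K V₁)
    (b₂ : Module.Basis (Fin n ⊕ Fin n) K V₂) (hL₁ : L₁ ≤ V₁) (hL₂ : L₂ ≤ V₂)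
    (hbL₁ : Submodule.span K (Set.range (⇑b₁ ∘ Sum.inr)) = L₁.comap V₁.subtype)
    (hbL₂ : Submodule.span K (Set.range (⇑b₂ ∘ Sum.inr)) = L₂.comap V₂.subtype) {N₁ N₂ : ℕ}
    (hN₁ : ExteriorLefschetz.twoVector b₁ ^ N₁ = 0) (hN₂ : ExteriorLefschetz.twoVector b₂ ^ N₂ = 0)
    {a₁ a₁' a₂ a₂' : K} (ha₁ : a₁ ≠ 0) (ha₁' : a₁' ≠ 0) (ha₂ : a₂ ≠ 0) (ha₂' : a₂' ≠ 0) :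
    finrank K (span ((L₁ ⊔ L₂ : Submodule K V) : Set V) {θ : Module.Dual K V | ∀ q ∈ L₁ ⊔ L₂, θ q = 0}
      (ExteriorAlgebra.map V₁.subtype (algebraMap K _ a₁ +
          a₁' • ∑ k ∈ Finset.range N₁, ((k.factorial : K)⁻¹) • ExteriorLefschetz.twoVector b₁ ^ k) *
        ExteriorAlgebra.map V₂.subtype (algebraMap K _ a₂ +
          a₂' • ∑ k ∈ Finset.range N₂, ((k.factorial : K)⁻¹) • ExteriorLefschetz.twoVector b₂ ^ k))) =
      6 * n ^ 2 - 2 * n := by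
  have hn2 : 2 ≤ n := by omega
  have hn0 : 0 < n := by omega
  rw [finrank_span_mul_eq hV hL₁ hL₂ (map_thetaSecant_mem_evenFactorAlg b₁ a₁ a₁' N₁)
      (map_thetaSecant_mem_evenFactorAlg b₂ a₂ a₂' N₂) (iSupIndep_spans_thetaSecant_map b₁ hV hL₁ hbL₁ hn0 hN₁ ha₁ ha₁').1
      (iSupIndep_spans_thetaSecant_map (V₂ := V₁) b₂ hV.symm hL₂ hbL₂ hn0 hN₂ ha₂ ha₂').2,
    finrank_span_thetaSecant_map b₁ hV hL₁ hbL₁ hn hN₁ ha₁ ha₁',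
    finrank_span_singleton_thetaSecant b₂ hV.symm hL₂ hbL₂ hn2 hN₂ ha₂ ha₂',
    finrank_span₁_thetaSecant_map b₁ hV hL₁ hbL₁ hn2 hN₁ ha₁ ha₁',
    finrank_span₁_thetaSecant_map b₂ hV.symm hL₂ hbL₂ hn2 hN₂ ha₂ ha₂',
    finrank_span_singleton_thetaSecant b₁ hV hL₁ hbL₁ hn2 hN₁ ha₁ ha₁',
    finrank_span_thetaSecant_map b₂ hV.symm hL₂ hbL₂ hn hN₂ ha₂ ha₂', two_mul_choose_two_box]

/-- **THE THETA BOX, `n = 2`: `dim = 1·1 + 4·4 + 1·1 = 18`.** [cite: BuchweitzFlenner2008HH, Prop. 6.4.4]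
[cite: BourbakiAlgebre1a3, Ch. III §7 no. 7 and §11 no. 9] -/
theorem finrank_span_thetaBox_two (hV : IsCompl V₁ V₂) (b₁ : Module.Basis (Fin 2 ⊕ Fin 2) K V₁)
    (b₂ : Module.Basis (Fin 2 ⊕ Fin 2) K V₂) (hL₁ : L₁ ≤ V₁) (hL₂ : L₂ ≤ V₂)
    (hbL₁ : Submodule.span K (Set.range (⇑b₁ ∘ Sum.inr)) = L₁.comap V₁.subtype)
    (hbL₂ : Submodule.span K (Set.range (⇑b₂ ∘ Sum.inr)) = L₂.comap V₂.subtype) {N₁ N₂ : ℕ}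
    (hN₁ : ExteriorLefschetz.twoVector b₁ ^ N₁ = 0) (hN₂ : ExteriorLefschetz.twoVector b₂ ^ N₂ = 0)
    {a₁ a₁' a₂ a₂' : K} (ha₁ : a₁ ≠ 0) (ha₁' : a₁' ≠ 0) (ha₂ : a₂ ≠ 0) (ha₂' : a₂' ≠ 0) :
    finrank K (span ((L₁ ⊔ L₂ : Submodule K V) : Set V) {θ : Module.Dual K V | ∀ q ∈ L₁ ⊔ L₂, θ q = 0}
      (ExteriorAlgebra.map V₁.subtype (algebraMap K _ a₁ +
          a₁' • ∑ k ∈ Finset.range N₁, ((k.factorial : K)⁻¹) • ExteriorLefschetz.twoVector b₁ ^ k) *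
        ExteriorAlgebra.map V₂.subtype (algebraMap K _ a₂ +
          a₂' • ∑ k ∈ Finset.range N₂, ((k.factorial : K)⁻¹) • ExteriorLefschetz.twoVector b₂ ^ k))) = 18 := by
  rw [finrank_span_mul_eq hV hL₁ hL₂ (map_thetaSecant_mem_evenFactorAlg b₁ a₁ a₁' N₁)
      (map_thetaSecant_mem_evenFactorAlg b₂ a₂ a₂' N₂)
      (iSupIndep_spans_thetaSecant_map b₁ hV hL₁ hbL₁ (by omega) hN₁ ha₁ ha₁').1
      (iSupIndep_spans_thetaSecant_map (V₂ := V₁) b₂ hV.symm hL₂ hbL₂ (by omega) hN₂ ha₂ ha₂').2]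
  have h1 : finrank K (span (L₁ : Set V) (factorForms L₁ V₂) (ExteriorAlgebra.map V₁.subtype (algebraMap K _ a₁ +
      a₁' • ∑ k ∈ Finset.range N₁, ((k.factorial : K)⁻¹) • ExteriorLefschetz.twoVector b₁ ^ k))) = 1 := by
    rw [finrank_span_map_eq hV hL₁, ← hbL₁]; exact finrank_span_thetaSecant_two b₁ hN₁ ha₁ ha₁'
  have h2 : finrank K (span (L₂ : Set V) (factorForms L₂ V₁) (ExteriorAlgebra.map V₂.subtype (algebraMap K _ a₂ +
      a₂' • ∑ k ∈ Finset.range N₂, ((k.factorial : K)⁻¹) • ExteriorLefschetz.twoVector b₂ ^ k))) = 1 := by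
    rw [finrank_span_map_eq hV.symm hL₂, ← hbL₂]; exact finrank_span_thetaSecant_two b₂ hN₂ ha₂ ha₂'
  rw [h1, h2, finrank_span_singleton_thetaSecant b₂ hV.symm hL₂ hbL₂ le_rfl hN₂ ha₂ ha₂',
    finrank_span₁_thetaSecant_map b₁ hV hL₁ hbL₁ le_rfl hN₁ ha₁ ha₁',
    finrank_span₁_thetaSecant_map b₂ hV.symm hL₂ hbL₂ le_rfl hN₂ ha₂ ha₂',
    finrank_span_singleton_thetaSecant b₁ hV hL₁ hbL₁ le_rfl hN₁ ha₁ ha₁']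

/-- **THE THETA BOX, `n = 1` (calibration row, abelian surface `E × E′`): `dim = 0·1 + 1·1 + 1·0 = 1`** — th-7's
`R₂(1) = [t²](1+t)² = 1`. [cite: BuchweitzFlenner2008HH, Prop. 6.4.4] [cite: BourbakiAlgebre1a3, Ch. III §7 no. 7] -/
theorem finrank_span_thetaBox_one (hV : IsCompl V₁ V₂) (b₁ : Module.Basis (Fin 1 ⊕ Fin 1) K V₁)
    (b₂ : Module.Basis (Fin 1 ⊕ Fin 1) K V₂) (hL₁ : L₁ ≤ V₁) (hL₂ : L₂ ≤ V₂)
    (hbL₁ : Submodule.span K (Set.range (⇑b₁ ∘ Sum.inr)) = L₁.comap V₁.subtype)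
    (hbL₂ : Submodule.span K (Set.range (⇑b₂ ∘ Sum.inr)) = L₂.comap V₂.subtype) {N₁ N₂ : ℕ}
    (hN₁ : ExteriorLefschetz.twoVector b₁ ^ N₁ = 0) (hN₂ : ExteriorLefschetz.twoVector b₂ ^ N₂ = 0)
    {a₁ a₁' a₂ a₂' : K} (ha₁ : a₁ ≠ 0) (ha₁' : a₁' ≠ 0) (ha₂ : a₂ ≠ 0) (ha₂' : a₂' ≠ 0) :
    finrank K (span ((L₁ ⊔ L₂ : Submodule K V) : Set V) {θ : Module.Dual K V | ∀ q ∈ L₁ ⊔ L₂, θ q = 0}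
      (ExteriorAlgebra.map V₁.subtype (algebraMap K _ a₁ +
          a₁' • ∑ k ∈ Finset.range N₁, ((k.factorial : K)⁻¹) • ExteriorLefschetz.twoVector b₁ ^ k) *
        ExteriorAlgebra.map V₂.subtype (algebraMap K _ a₂ +
          a₂' • ∑ k ∈ Finset.range N₂, ((k.factorial : K)⁻¹) • ExteriorLefschetz.twoVector b₂ ^ k))) = 1 := by
  -- `K·xᵢ` is a line: `xᵢ ≠ 0` since its degree-one span has dimension `1`
  have hs₁ : finrank K (K ∙ ExteriorAlgebra.map V₁.subtype (algebraMap K _ a₁ +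
      a₁' • ∑ k ∈ Finset.range N₁, ((k.factorial : K)⁻¹) • ExteriorLefschetz.twoVector b₁ ^ k)) = 1 := by
    refine finrank_span_singleton fun h0 => ?_
    have h := finrank_span₁_thetaSecant_map_one b₁ hV hL₁ hbL₁ hN₁ ha₁ ha₁' (V₂ := V₂)
    rw [h0, span₁_zero, finrank_bot] at h
    exact zero_ne_one h
  have hs₂ : finrank K (K ∙ ExteriorAlgebra.map V₂.subtype (algebraMap K _ a₂ +
      a₂' • ∑ k ∈ Finset.range N₂, ((k.factorial : K)⁻¹) • ExteriorLefschetz.twoVector b₂ ^ k)) = 1 := by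
    refine finrank_span_singleton fun h0 => ?_
    have h := finrank_span₁_thetaSecant_map_one b₂ hV.symm hL₂ hbL₂ hN₂ ha₂ ha₂' (V₂ := V₁)
    rw [h0, span₁_zero, finrank_bot] at h
    exact zero_ne_one h
  rw [finrank_span_mul_eq hV hL₁ hL₂ (map_thetaSecant_mem_evenFactorAlg b₁ a₁ a₁' N₁)
      (map_thetaSecant_mem_evenFactorAlg b₂ a₂ a₂' N₂)
      (iSupIndep_spans_thetaSecant_map b₁ hV hL₁ hbL₁ Nat.one_pos hN₁ ha₁ ha₁').1
      (iSupIndep_spans_thetaSecant_map (V₂ := V₁) b₂ hV.symm hL₂ hbL₂ Nat.one_pos hN₂ ha₂ ha₂').2,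
    finrank_span_thetaSecant_map_one b₁ hV hL₁ hbL₁ hN₁ ha₁ ha₁', hs₂,
    finrank_span₁_thetaSecant_map_one b₁ hV hL₁ hbL₁ hN₁ ha₁ ha₁',
    finrank_span₁_thetaSecant_map_one b₂ hV.symm hL₂ hbL₂ hN₂ ha₂ ha₂', hs₁,
    finrank_span_thetaSecant_map_one b₂ hV.symm hL₂ hbL₂ hN₂ ha₂ ha₂']

end Box

end ContractionSpan

/-! ### Real carriers: `contractionRank A κ` for a theta-box class -/

section Real
variable {A : AbelianVariety ℂ} {V₁ V₂ L₁ L₂ : Submodule ℂ (complexBetti A.X 1)}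

/-- **`r(A, κ) = 6n² − 2n` for a THETA-BOX class on an abelian variety of dimension `2n`, `n ≥ 3`**: if
`H¹(A) = V₁ ⊕ V₂`, `H^{0,1}(A) = L₁ ⊕ L₂` with `Lᵢ ⊆ Vᵢ` spanned by the `q`'s of Darboux bases `bᵢ` of `Vᵢ`, and the total
class of `κ` in `Λ H¹(A)` is `(a₁ + a₁' e^{c₁}) ∧ (a₂ + a₂' e^{c₂})`, `cᵢ = Σ p ∧ q` the 2-vectors of the `bᵢ` (the shape of
`ch((i_*L)^∨ ⊠ i_*L')` on `X × X̂` for two-term theta classes, BY VALUE), then `contractionRank A κ = 6n² − 2n`.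
[cite: BuchweitzFlenner2008HH, Prop. 6.4.4] [cite: MumfordAV1970, §1 (4) and §4 (iii)] -/
theorem contractionRank_thetaBox (hA : IsSmoothProjective A.dim A.X) (κ : ∀ p : ℕ, complexBetti A.X (2 * p)) {n : ℕ}
    (hn : 3 ≤ n) (hV : IsCompl V₁ V₂) (b₁ : Module.Basis (Fin n ⊕ Fin n) ℂ V₁) (b₂ : Module.Basis (Fin n ⊕ Fin n) ℂ V₂)
    (hL : hodgeZeroOne hA = L₁ ⊔ L₂) (hL₁ : L₁ ≤ V₁) (hL₂ : L₂ ≤ V₂)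
    (hbL₁ : Submodule.span ℂ (Set.range (⇑b₁ ∘ Sum.inr)) = L₁.comap V₁.subtype)
    (hbL₂ : Submodule.span ℂ (Set.range (⇑b₂ ∘ Sum.inr)) = L₂.comap V₂.subtype) {N₁ N₂ : ℕ}
    (hN₁ : ExteriorLefschetz.twoVector b₁ ^ N₁ = 0) (hN₂ : ExteriorLefschetz.twoVector b₂ ^ N₂ = 0)
    {a₁ a₁' a₂ a₂' : ℂ} (ha₁ : a₁ ≠ 0) (ha₁' : a₁' ≠ 0) (ha₂ : a₂ ≠ 0) (ha₂' : a₂' ≠ 0)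
    (hx : totalExteriorClass A κ =
      ExteriorAlgebra.map V₁.subtype (algebraMap ℂ _ a₁ +
          a₁' • ∑ k ∈ Finset.range N₁, ((k.factorial : ℂ)⁻¹) • ExteriorLefschetz.twoVector b₁ ^ k) *
        ExteriorAlgebra.map V₂.subtype (algebraMap ℂ _ a₂ +
          a₂' • ∑ k ∈ Finset.range N₂, ((k.factorial : ℂ)⁻¹) • ExteriorLefschetz.twoVector b₂ ^ k)) :
    contractionRank A κ = ((6 * n ^ 2 - 2 * n : ℕ) : Cardinal) := by
  haveI : Module.Finite ℂ (complexBetti A.X 1) := abelianVarietyCohomologyExteriorH1_holds.finite_one A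
  haveI : FiniteDimensional ℂ (ExteriorAlgebra ℂ (complexBetti A.X 1)) := ContractionSpan.finiteDimensional_exteriorAlgebra
  rw [contractionRank_eq_rank_span, ← Module.finrank_eq_rank, hx, vectorFieldSet_eq A hA rfl,
    ← coe_hodgeZeroOne_eq_hodgeZeroOneSet A hA rfl, hL,
    ContractionSpan.finrank_span_thetaBox hV hn b₁ b₂ hL₁ hL₂ hbL₁ hbL₂ hN₁ hN₂ ha₁ ha₁' ha₂ ha₂']

/-- **`r(A, κ) = 18` for a theta-box class on an abelian FOURFOLD** (`n = 2`). [cite: BuchweitzFlenner2008HH, Prop. 6.4.4]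
[cite: MumfordAV1970, §1 (4) and §4 (iii)] -/
theorem contractionRank_thetaBox_two (hA : IsSmoothProjective A.dim A.X) (κ : ∀ p : ℕ, complexBetti A.X (2 * p))
    (hV : IsCompl V₁ V₂) (b₁ : Module.Basis (Fin 2 ⊕ Fin 2) ℂ V₁) (b₂ : Module.Basis (Fin 2 ⊕ Fin 2) ℂ V₂)
    (hL : hodgeZeroOne hA = L₁ ⊔ L₂) (hL₁ : L₁ ≤ V₁) (hL₂ : L₂ ≤ V₂)
    (hbL₁ : Submodule.span ℂ (Set.range (⇑b₁ ∘ Sum.inr)) = L₁.comap V₁.subtype)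
    (hbL₂ : Submodule.span ℂ (Set.range (⇑b₂ ∘ Sum.inr)) = L₂.comap V₂.subtype) {N₁ N₂ : ℕ}
    (hN₁ : ExteriorLefschetz.twoVector b₁ ^ N₁ = 0) (hN₂ : ExteriorLefschetz.twoVector b₂ ^ N₂ = 0)
    {a₁ a₁' a₂ a₂' : ℂ} (ha₁ : a₁ ≠ 0) (ha₁' : a₁' ≠ 0) (ha₂ : a₂ ≠ 0) (ha₂' : a₂' ≠ 0)
    (hx : totalExteriorClass A κ =
      ExteriorAlgebra.map V₁.subtype (algebraMap ℂ _ a₁ +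
          a₁' • ∑ k ∈ Finset.range N₁, ((k.factorial : ℂ)⁻¹) • ExteriorLefschetz.twoVector b₁ ^ k) *
        ExteriorAlgebra.map V₂.subtype (algebraMap ℂ _ a₂ +
          a₂' • ∑ k ∈ Finset.range N₂, ((k.factorial : ℂ)⁻¹) • ExteriorLefschetz.twoVector b₂ ^ k)) :
    contractionRank A κ = 18 := by
  haveI : Module.Finite ℂ (complexBetti A.X 1) := abelianVarietyCohomologyExteriorH1_holds.finite_one A
  haveI : FiniteDimensional ℂ (ExteriorAlgebra ℂ (complexBetti A.X 1)) := ContractionSpan.finiteDimensional_exteriorAlgebra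
  rw [contractionRank_eq_rank_span, ← Module.finrank_eq_rank, hx, vectorFieldSet_eq A hA rfl,
    ← coe_hodgeZeroOne_eq_hodgeZeroOneSet A hA rfl, hL,
    ContractionSpan.finrank_span_thetaBox_two hV b₁ b₂ hL₁ hL₂ hbL₁ hbL₂ hN₁ hN₂ ha₁ ha₁' ha₂ ha₂', Nat.cast_ofNat]

end Real

end Summit.Ventures.HSemireg

end
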